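import Summits.ResolutionOfSingularities.ResolutionOfSingularities.Theorems.DescentDescentPerfectToAllSingularLocusDescends
import Mathlib.AlgebraicGeometry.Morphisms.QuasiCompact

/-!
# `DescentPerfectToAll` (stmt-ResolutionOfSingularities-0549): the singular locus of `Y ×_K k`
# descends to a finite level — scheme form

Route `ResolutionOfSingularities/Descent`, crux `DescentPerfectToAll`. Helper file (OURS;
`--supports` the crux, does not close it; NOT a statement of any manuscript). Globalization of
`exists_finset_isRegularLocalRing_iff_level` (`DescentDescentPerfectToAllSingularLocusDescends.lean`)
from a finitely generated `K`-algebra to a `K`-scheme `q : Y → Spec K` of finite type: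

* `specTensorChart_comp_levelMap` — the affine charts `Spec (Γ(Y,W) ⊗_K k)`, `Spec (Γ(Y,W) ⊗_K E)`
  of `Y ×_K k`, `Y ×_K E` (tree `specTensorChart`) are intertwined by `Spec` of the base-change map
  `ι_E : Γ ⊗_K E → Γ ⊗_K k`, for any level map `τ : Y ×_K k → Y ×_K E` over `Y` and over
  `Spec k → Spec E`.
* `isRegularLocalRing_stalk_iff_level_of_chart` — one chart: the ring-level comparison gives the
  comparison of local rings at `z` and `τ z`.
* `exists_finset_isRegularLocalRing_stalk_iff_level` (`Y` quasi-compact, `q` locally of finite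
  type) / `…_level'` (`QuasiCompact q`) — **there is a finite `C ⊆ k` such that for every
  intermediate level `K → E → k` containing `C`, every level map `τ`, and every point `z` of
  `Y ×_K k`: `𝒪_{Y_k, z}` is regular iff `𝒪_{Y_E, τ z}` is regular**, i.e.
  `Reg(Y ×_K k) = τ⁻¹ Reg(Y ×_K E)` and `Sing(Y ×_K k) = τ⁻¹ Sing(Y ×_K E)`.
* `exists_finset_isRegular_pullback_iff_level` — for such `E` (and `τ` surjective, as the canonical
  projection is), `Y ×_K k` is regular iff `Y ×_K E` is regular.

Reading for the crux: in a tower `k = ⋃ K_m` of finitely generated levels over a field of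
definition of `X_k`, the models `X_m = X_0 ×_{K_0} K_m` satisfy `Reg(X_m) ×_{K_m} k = Reg(X_k)`
for all `m ≫ 0` (no new singularities appear above regular points of high models; the obstruction
`RegularNotGeometricallyRegular` is a LOW-level phenomenon for the models themselves). The
exceptional loci of RESOLUTIONS of the models are not addressed (they can be non-robust at every
fixed level, `STRATEGY-CENSUS.md` §2.4 of the crux).

[cite: Matsumura1987, Thm. 23.7 and §30 Cor. to Thm. 30.5] [folklore]
-/

noncomputable section

set_option linter.dupNamespace false -- mandated namespace of this single-conjunct summit

open TensorProduct IsLocalRing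
open Literature.AlgebraicGeometry.Resolution

namespace Summit.ResolutionOfSingularities.ResolutionOfSingularities.Theorems

universe u

/-! ## Scheme level: `Y ×_K k` versus `Y ×_K E` for `Y` of finite type over `K` -/

section Scheme

open CategoryTheory CategoryTheory.Limits AlgebraicGeometry

variable {K k : Type u} [Field K] [Field k] [Algebra K k]

/-- **Chart compatibility of the level map.** For a morphism `τ : Y ×_K k → Y ×_K E` over `Y`
and over `Spec k → Spec E`, and an affine open `i : Spec B ↪ Y` with `i ≫ q = Spec (K → B)`, the
affine charts `Spec (B ⊗_K k)`, `Spec (B ⊗_K E)` of the two base changes are intertwined by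
`Spec` of the base-change map `ι_E : B ⊗_K E → B ⊗_K k`. [folklore] -/
theorem specTensorChart_comp_levelMap (E : Type u) [Field E] [Algebra K E] [Algebra E k]
    [IsScalarTower K E k] {Y : Scheme.{u}} (q : Y ⟶ Spec (.of K))
    (τ : pullback q (specOfAlgebra K k) ⟶ pullback q (specOfAlgebra K E))
    (hτ₁ : τ ≫ pullback.fst q (specOfAlgebra K E) = pullback.fst q (specOfAlgebra K k))
    (hτ₂ : τ ≫ pullback.snd q (specOfAlgebra K E) =
      pullback.snd q (specOfAlgebra K k) ≫ Spec.map (CommRingCat.ofHom (algebraMap E k)))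
    {B : Type u} [CommRing B] [Algebra K B] (i : Spec (.of B) ⟶ Y)
    (hi : i ≫ q = Spec.map (CommRingCat.ofHom (algebraMap K B))) :
    specTensorChart k q i hi ≫ τ =
      Spec.map (CommRingCat.ofHom
        (Algebra.TensorProduct.lTensor (S := K) B (IsScalarTower.toAlgHom K E k)).toRingHom) ≫
        specTensorChart E q i hi := by
  set ι := (Algebra.TensorProduct.lTensor (S := K) B (IsScalarTower.toAlgHom K E k)).toRingHom
    with hι
  apply pullback.hom_ext
  · rw [Category.assoc, hτ₁, specTensorChart_fst, Category.assoc, specTensorChart_fst,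
      ← Spec.map_comp_assoc, ← CommRingCat.ofHom_comp]
    congr 3
    ext b
    simp [hι, Algebra.TensorProduct.includeLeftRingHom]
  · rw [Category.assoc, hτ₂, specTensorChart_snd_assoc, Category.assoc, specTensorChart_snd,
      ← Spec.map_comp, ← Spec.map_comp, ← CommRingCat.ofHom_comp, ← CommRingCat.ofHom_comp]
    congr 2

/-- **One chart.** If the ring-level comparison holds for `B` at the level `E` (every prime `𝔓`
of `B ⊗_K k` is regular iff `ι_E⁻¹ 𝔓` is), then for every point `z` of `Y ×_K k` in the chart
`Spec (B ⊗_K k)` over an affine open `Spec B ↪ Y`, the local ring of `Y ×_K k` at `z` is regular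
iff the local ring of `Y ×_K E` at `τ z` is regular. [folklore] -/
theorem isRegularLocalRing_stalk_iff_level_of_chart (E : Type u) [Field E] [Algebra K E]
    [Algebra E k] [IsScalarTower K E k] {Y : Scheme.{u}} (q : Y ⟶ Spec (.of K))
    (τ : pullback q (specOfAlgebra K k) ⟶ pullback q (specOfAlgebra K E))
    (hτ₁ : τ ≫ pullback.fst q (specOfAlgebra K E) = pullback.fst q (specOfAlgebra K k))
    (hτ₂ : τ ≫ pullback.snd q (specOfAlgebra K E) =
      pullback.snd q (specOfAlgebra K k) ≫ Spec.map (CommRingCat.ofHom (algebraMap E k)))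
    {B : Type u} [CommRing B] [Algebra K B] (i : Spec (.of B) ⟶ Y) [IsOpenImmersion i]
    (hi : i ≫ q = Spec.map (CommRingCat.ofHom (algebraMap K B)))
    (hB : ∀ (𝔓 : Ideal (B ⊗[K] k)) [𝔓.IsPrime],
      IsRegularLocalRing (Localization.AtPrime 𝔓) ↔
      IsRegularLocalRing (Localization.AtPrime (𝔓.comap
        (Algebra.TensorProduct.lTensor (S := K) B (IsScalarTower.toAlgHom K E k)).toRingHom)))
    (z : ↑(pullback q (specOfAlgebra K k))) (hz : z ∈ Set.range (specTensorChart k q i hi)) :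
    IsRegularLocalRing ((pullback q (specOfAlgebra K k)).presheaf.stalk z) ↔
      IsRegularLocalRing ((pullback q (specOfAlgebra K E)).presheaf.stalk (τ z)) := by
  set ι := (Algebra.TensorProduct.lTensor (S := K) B (IsScalarTower.toAlgHom K E k)).toRingHom
    with hι
  obtain ⟨ζ, rfl⟩ := hz
  have hpt : τ (specTensorChart k q i hi ζ) =
      specTensorChart E q i hi (PrimeSpectrum.comap ι ζ) := by
    rw [← Scheme.Hom.comp_apply, specTensorChart_comp_levelMap E q τ hτ₁ hτ₂ i hi,
      Scheme.Hom.comp_apply, Spec.map_apply, CommRingCat.hom_ofHom]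
  rw [hpt, isRegularLocalRing_stalk_iff_of_isOpenImmersion (specTensorChart k q i hi) ζ,
    isRegularLocalRing_stalk_iff_of_isOpenImmersion (specTensorChart E q i hi),
    isRegularLocalRing_stalk_Spec_iff, isRegularLocalRing_stalk_Spec_iff]
  exact hB ζ.asIdeal

/-- **The singular locus of `Y ×_K k` descends to a finite level, uniformly** (scheme form). Let
`q : Y → Spec K` be of finite type (locally of finite type, `Y` quasi-compact) and `K → k` a field
extension. There is a finite `C ⊆ k` such that for every intermediate level `K → E → k` whose
image contains `C`, every morphism `τ : Y ×_K k → Y ×_K E` over `Y` and over `Spec k → Spec E`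
(the canonical projection), and every point `z` of `Y ×_K k`: the local ring at `z` is regular iff
the local ring of `Y ×_K E` at `τ z` is regular — i.e. `Sing(Y ×_K k) = τ⁻¹ Sing(Y ×_K E)` and
`Reg(Y ×_K k) = τ⁻¹ Reg(Y ×_K E)`. (Finitely many affine charts, and
`exists_finset_isRegularLocalRing_iff_level` in each.) [cite: Matsumura1987, Thm. 23.7] -/
theorem exists_finset_isRegularLocalRing_stalk_iff_level {Y : Scheme.{u}}
    (q : Y ⟶ Spec (.of K)) [LocallyOfFiniteType q] [CompactSpace ↑Y] :
    ∃ C : Finset k, ∀ (E : Type u) [Field E] [Algebra K E] [Algebra E k] [IsScalarTower K E k],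
      (↑C : Set k) ⊆ Set.range (algebraMap E k) →
      ∀ (τ : pullback q (specOfAlgebra K k) ⟶ pullback q (specOfAlgebra K E)),
        τ ≫ pullback.fst q (specOfAlgebra K E) = pullback.fst q (specOfAlgebra K k) →
        τ ≫ pullback.snd q (specOfAlgebra K E) =
          pullback.snd q (specOfAlgebra K k) ≫ Spec.map (CommRingCat.ofHom (algebraMap E k)) →
        ∀ z : ↑(pullback q (specOfAlgebra K k)),
          IsRegularLocalRing ((pullback q (specOfAlgebra K k)).presheaf.stalk z) ↔
          IsRegularLocalRing ((pullback q (specOfAlgebra K E)).presheaf.stalk (τ z)) := by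
  classical
  -- affine charts `Spec Γ(Y, W y) ↪ Y`, `W y ∋ y`, of finite type over `K`
  have hW : ∀ y : Y, ∃ W : Y.Opens, IsAffineOpen W ∧ y ∈ W := fun y => by
    obtain ⟨W, hW, hyW, -⟩ := exists_isAffineOpen_mem_and_subset (X := Y) (x := y) (U := ⊤) trivial
    exact ⟨W, hW, hyW⟩
  choose W hWaff hyW using hW
  -- the per-chart finite sets
  have key : ∀ y : Y, ∃ C : Finset k,
      ∀ (E : Type u) [Field E] [Algebra K E] [Algebra E k] [IsScalarTower K E k],
      (↑C : Set k) ⊆ Set.range (algebraMap E k) →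
      ∀ (τ : pullback q (specOfAlgebra K k) ⟶ pullback q (specOfAlgebra K E)),
        τ ≫ pullback.fst q (specOfAlgebra K E) = pullback.fst q (specOfAlgebra K k) →
        τ ≫ pullback.snd q (specOfAlgebra K E) =
          pullback.snd q (specOfAlgebra K k) ≫ Spec.map (CommRingCat.ofHom (algebraMap E k)) →
        ∀ z : ↑(pullback q (specOfAlgebra K k)),
          pullback.fst q (specOfAlgebra K k) z ∈ (W y : Set Y) →
          (IsRegularLocalRing ((pullback q (specOfAlgebra K k)).presheaf.stalk z) ↔
            IsRegularLocalRing ((pullback q (specOfAlgebra K E)).presheaf.stalk (τ z))) := by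
    intro y
    let iW : Spec Γ(Y, W y) ⟶ Y := (hWaff y).fromSpec
    let φ₀ : CommRingCat.of K ⟶ Γ(Y, W y) := Spec.preimage (iW ≫ q)
    letI : Algebra K Γ(Y, W y) := φ₀.hom.toAlgebra
    have hi : iW ≫ q = Spec.map (CommRingCat.ofHom (algebraMap K Γ(Y, W y))) := by
      rw [RingHom.algebraMap_toAlgebra, CommRingCat.ofHom_hom, Spec.map_preimage]
    haveI : Algebra.FiniteType K Γ(Y, W y) := by
      have h1 : LocallyOfFiniteType (Spec.map (CommRingCat.ofHom (algebraMap K Γ(Y, W y)))) := by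
        rw [← hi]; infer_instance
      have h2 := (HasRingHomProperty.Spec_iff (P := @LocallyOfFiniteType)).mp h1
      exact RingHom.finiteType_algebraMap.mp h2
    obtain ⟨C, hC⟩ := exists_finset_isRegularLocalRing_iff_level K k Γ(Y, W y)
    refine ⟨C, fun E _ _ _ _ hCE τ hτ₁ hτ₂ z hz => ?_⟩
    refine isRegularLocalRing_stalk_iff_level_of_chart E q τ hτ₁ hτ₂ iW hi
      (fun 𝔓 _ => hC E hCE 𝔓) z ?_
    rw [range_specTensorChart, Set.mem_preimage, IsAffineOpen.range_fromSpec]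
    exact hz
  choose Cf hCf using key
  -- finitely many charts cover `Y`
  obtain ⟨t, ht⟩ := isCompact_univ.elim_finite_subcover (fun y : Y => (W y : Set Y))
    (fun y => (W y).isOpen) (fun y _ => Set.mem_iUnion.mpr ⟨y, hyW y⟩)
  refine ⟨t.biUnion Cf, fun E _ _ _ _ hCE τ hτ₁ hτ₂ z => ?_⟩
  obtain ⟨y, hyt, hzy⟩ : ∃ y ∈ t, pullback.fst q (specOfAlgebra K k) z ∈ (W y : Set Y) := by
    have h := ht (Set.mem_univ (pullback.fst q (specOfAlgebra K k) z))
    simp only [Set.mem_iUnion] at h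
    obtain ⟨y, hy, hzy⟩ := h
    exact ⟨y, hy, hzy⟩
  refine hCf y E (fun c hc => hCE ?_) τ hτ₁ hτ₂ z hzy
  rw [Finset.coe_biUnion, Set.mem_iUnion₂]
  exact ⟨y, hyt, hc⟩

/-- The same with the finite-type hypothesis in the form of the crux (`QuasiCompact q`): `Y` is then
quasi-compact since `Spec K` is. [cite: Matsumura1987, Thm. 23.7] -/
theorem exists_finset_isRegularLocalRing_stalk_iff_level' {Y : Scheme.{u}}
    (q : Y ⟶ Spec (.of K)) [LocallyOfFiniteType q] [QuasiCompact q] :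
    ∃ C : Finset k, ∀ (E : Type u) [Field E] [Algebra K E] [Algebra E k] [IsScalarTower K E k],
      (↑C : Set k) ⊆ Set.range (algebraMap E k) →
      ∀ (τ : pullback q (specOfAlgebra K k) ⟶ pullback q (specOfAlgebra K E)),
        τ ≫ pullback.fst q (specOfAlgebra K E) = pullback.fst q (specOfAlgebra K k) →
        τ ≫ pullback.snd q (specOfAlgebra K E) =
          pullback.snd q (specOfAlgebra K k) ≫ Spec.map (CommRingCat.ofHom (algebraMap E k)) →
        ∀ z : ↑(pullback q (specOfAlgebra K k)),
          IsRegularLocalRing ((pullback q (specOfAlgebra K k)).presheaf.stalk z) ↔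
          IsRegularLocalRing ((pullback q (specOfAlgebra K E)).presheaf.stalk (τ z)) := by
  haveI : CompactSpace ↑Y := QuasiCompact.compactSpace_of_compactSpace q
  exact exists_finset_isRegularLocalRing_stalk_iff_level q

/-- **Regularity of `Y ×_K k` is decided at a finite level**: with `C` as above, for every level
`E ⊇ C` admitting a level map `τ`, `Y ×_K k` is regular iff `Y ×_K E` is regular. (For `⟸` the
tree already has the level-free `isRegular_pullback_of_fgLevels`; the point here is `⟹` at ONE
high level, false at low levels.) [cite: Matsumura1987, Thm. 23.7] -/
theorem exists_finset_isRegular_pullback_iff_level {Y : Scheme.{u}}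
    (q : Y ⟶ Spec (.of K)) [LocallyOfFiniteType q] [CompactSpace ↑Y] :
    ∃ C : Finset k, ∀ (E : Type u) [Field E] [Algebra K E] [Algebra E k] [IsScalarTower K E k],
      (↑C : Set k) ⊆ Set.range (algebraMap E k) →
      ∀ (τ : pullback q (specOfAlgebra K k) ⟶ pullback q (specOfAlgebra K E)),
        τ ≫ pullback.fst q (specOfAlgebra K E) = pullback.fst q (specOfAlgebra K k) →
        τ ≫ pullback.snd q (specOfAlgebra K E) =
          pullback.snd q (specOfAlgebra K k) ≫ Spec.map (CommRingCat.ofHom (algebraMap E k)) →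
        Function.Surjective τ →
        (Scheme.IsRegular (pullback q (specOfAlgebra K k)) ↔
          Scheme.IsRegular (pullback q (specOfAlgebra K E))) := by
  obtain ⟨C, hC⟩ := exists_finset_isRegularLocalRing_stalk_iff_level (k := k) q
  refine ⟨C, fun E _ _ _ _ hCE τ hτ₁ hτ₂ hsurj => ⟨fun hk y => ?_, fun hE z => ?_⟩⟩
  · obtain ⟨z, rfl⟩ := hsurj y
    exact (hC E hCE τ hτ₁ hτ₂ z).mp (hk z)
  · exact (hC E hCE τ hτ₁ hτ₂ z).mpr (hE (τ z))

end Scheme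

end Summit.ResolutionOfSingularities.ResolutionOfSingularities.Theorems

end
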